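import Summits.HodgeConjecture.HodgeConjecture.Theorems.HeckePrymWeilWeilTwelvefoldsSqrtMinus7Descent
import Summits.HodgeConjecture.HodgeConjecture.Theorems.HeckePrymWeilWeilTwelvefoldsSqrtMinus7HodgeTypeExterior
import Literature.NumberTheory.Transcendental.DeRhamTheoremMultiplicative
import HarnessLib

/-!
# Crux `WeilTwelvefoldsSqrtMinus7` (stmt-HodgeConjecture-1261), line `isotypic-unimodular-saturation` — stub `stub_descent`

**Schoen's descent `14 → 12` for ONE partner surface with a descent pair** (C. Schoen, Compositio
Math. 114 (1998), §10; E. Markman, arXiv:2509.23403 §11.5 Step 2), unconditionally: the sibling line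
`amnesic-secant-sheaves-split-fourteenfolds` proved the same statement GIVEN Künneth for Hodge types
(`AmnesicSecantSheaves.stub_descent`), and Künneth for Hodge types GIVEN de Rham's theorem in
multiplicative form (`AmnesicSecantSheaves.stub_hodgeTypeExterior`); de Rham's theorem is the tree's
theorem `Literature.NumberTheory.Transcendental.exists_deRhamIsoFamily_holds`
(`DeRhamTheoremMultiplicative`). This file composes the three. No named fact is taken.
-/

noncomputable section

set_option linter.dupNamespace false

open CategoryTheory
open Literature.AlgebraicGeometry Literature.AlgebraicGeometry.Motives
  Literature.AlgebraicGeometry.HodgeTheory Literature.AlgebraicTopology.SingularHomology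

namespace Summit.HodgeConjecture.HodgeConjecture.Theorems.WeilTwelvefoldsSqrtMinus7.IsotypicUnimodularSaturation

/-- **Stub `stub_descent` (Stub 6) of line `isotypic-unimodular-saturation`, crux
`WeilTwelvefoldsSqrtMinus7` (stmt-HodgeConjecture-1261): Schoen/Koike descent `14 → 12` for ONE
partner surface.** Let `(A, φ)` be a complex abelian 12-fold and `(B, φ_B)` a complex abelian surface
with `φ² = φ_B² = -7`, `B` carrying a descent pair `(b₊, b₋, η)` (`b± ∈ Eig((𝟙+φ_B)^*, (1 ± i√7)²)`,
`b₊ + b₋` rational of type `(1,1)`, `η` algebraic, `b± ⌣ η ≠ 0`), and `ψ = φ × φ_B` on `A × B`. If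
every rational `(7,7)`-class of the typed Weil plane `Eig((𝟙+ψ)^*, (1+i√7)¹⁴) ⊔ Eig((𝟙+ψ)^*, (1-i√7)¹⁴)`
of `A × B` is algebraic, then every rational `(6,6)`-class of the typed Weil plane of `A` is
algebraic. Proof: `AmnesicSecantSheaves.stub_descent` (the same statement given Künneth for Hodge
types), fed by `AmnesicSecantSheaves.stub_hodgeTypeExterior` (Künneth for Hodge types given de Rham's
theorem in multiplicative form) and `exists_deRhamIsoFamily_holds` (de Rham's theorem).
[cite: Schoen1998HodgeWeilAddendum, §10 Proposition] [cite: Markman2025SurveySecant, §11.5 Step 2] -/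
theorem stub_descent :
    ∀ (A : AbelianVariety ℂ) (φ : A ⟶ A) (B : AbelianVariety ℂ) (φB : B ⟶ B),
      A.dim = 12 → B.dim = 2 → φ ≫ φ = -((7 : ℤ) • 𝟙 A) → φB ≫ φB = -((7 : ℤ) • 𝟙 B) →
      (∃ bp bm η : complexBetti B.X 2,
        bp ∈ Module.End.eigenspace (complexBetti.map (𝟙 B + φB).hom.hom.hom 2).hom
              ((1 + Complex.I * (Real.sqrt (7 : ℝ) : ℂ)) ^ 2) ∧
        bm ∈ Module.End.eigenspace (complexBetti.map (𝟙 B + φB).hom.hom.hom 2).hom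
              ((1 - Complex.I * (Real.sqrt (7 : ℝ) : ℂ)) ^ 2) ∧
        IsRationalClass (bp + bm) ∧ IsOfHodgeType 2 B.X 2 1 1 (bp + bm) ∧
        η ∈ algebraicClasses B.X 1 ∧
        cupProduct (show 2 + 2 = 4 from rfl) bp η ≠ 0 ∧
        cupProduct (show 2 + 2 = 4 from rfl) bm η ≠ 0) →
      (∀ u : complexBetti (A.prod B).X 14, IsRationalClass u → IsOfHodgeType 14 (A.prod B).X 14 7 7 u →
        u ∈ Module.End.eigenspace (complexBetti.map (𝟙 (A.prod B) +
                AbelianVariety.prodLift (AbelianVariety.fst A B ≫ φ) (AbelianVariety.snd A B ≫ φB)).hom.hom.hom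
                14).hom ((1 + Complex.I * (Real.sqrt (7 : ℝ) : ℂ)) ^ 14) ⊔
            Module.End.eigenspace (complexBetti.map (𝟙 (A.prod B) +
                AbelianVariety.prodLift (AbelianVariety.fst A B ≫ φ) (AbelianVariety.snd A B ≫ φB)).hom.hom.hom
                14).hom ((1 - Complex.I * (Real.sqrt (7 : ℝ) : ℂ)) ^ 14) →
        u ∈ algebraicClasses (A.prod B).X 7) →
      ∀ c : complexBetti A.X 12, IsRationalClass c → IsOfHodgeType 12 A.X 12 6 6 c →
        c ∈ Module.End.eigenspace (complexBetti.map (𝟙 A + φ).hom.hom.hom 12).hom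
              ((1 + Complex.I * (Real.sqrt (7 : ℝ) : ℂ)) ^ 12) ⊔
            Module.End.eigenspace (complexBetti.map (𝟙 A + φ).hom.hom.hom 12).hom
              ((1 - Complex.I * (Real.sqrt (7 : ℝ) : ℂ)) ^ 12) →
        c ∈ algebraicClasses A.X 6 :=
  AmnesicSecantSheaves.stub_descent
    (AmnesicSecantSheaves.stub_hodgeTypeExterior
      fun E _ _ _ => Literature.NumberTheory.Transcendental.exists_deRhamIsoFamily_holds E)

end Summit.HodgeConjecture.HodgeConjecture.Theorems.WeilTwelvefoldsSqrtMinus7.IsotypicUnimodularSaturation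

end
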